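/-
Copyright (c) 2026 the pub-hodgecm-mathlib formalisation cell (harness21).  Prover seat hodgecm-mathlib-K2E3-p17 (g2),
Track B «K2-LIT» ∕ h413, line `K2_E3_EllipticInputs`, unit U5 — ROAD K-EP toward #20′ `sig_K2E3PseudoCoeffPosOnePi2`, THIRD BRICK sub-brick (3a″):
ON A RANK-ONE FINITE HOMOGENEOUS SPACE, A NON-SPHERICAL TRANSLATION-STABLE SPACE WITH A `B`-FIXED VECTOR IS THE MEAN-ZERO HYPERPLANE.  2026-09-04.
-/
import Mathlib
import HarnessLib

/-!
# K2_E3 road K-EP (#20′, POS-ONE at `π²(ξ)`), third brick (3a″): the mean-zero hyperplane on a rank-one finite homogeneous space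

Cell `pub/hodgecm-mathlib` (D-0151), Track B; dealer K2E3-plan (g1) 23:40:43Z (e) «#20′ ↦ K2E3-p17»; K2E3-p17 (g2) REPORT-FIRST 23:50:39Z (third brick
cut (3a)–(3e)) and its refinement (uniform SUB-constituent argument, 00:2xZ).  THEOREMS ONLY; Mathlib-only; GENERIC (any group `G`, finite `G`-set `X`,
field of characteristic zero).  Companion of ★ p855843 `K2E3PermutationModuleBorelFixedConstant` (the averaging lemma = the SPHERICAL case).

WHY.  At depth zero, `V = i_G(χ₁) ⊇ {π²(ξ₀), πⁿ(ξ₀)}` has `V^{K₀⁺}|_{K₀} ≅ Fun(K₀∕I)` (Mackey), a RANK-ONE permutation module: `I` fixes the base point and is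
transitive on the other `[K₀:I] − 1 = q³` points (`K₀ = I ⊔ I w̃ I`).  The irreducible SUB-constituent `S ∈ {π², πⁿ}` of `V` has `dim S^{I} = 1`; its
`K₀⁺`-fixed space `N = S^{K₀⁺} ≤ Fun(K₀∕I)` is translation-stable with a non-zero `I`-fixed vector.  Two cases: `𝟙 ∈ N` (S spherical ⇒ ★ averaging lemma:
`dim N = 1`) or `𝟙 ∉ N` (S not spherical ⇒ THIS FILE: `N` = the mean-zero functions, `dim N = [K₀:I] − 1 = q³`).  Either way the non-spherical constituent
`π²(ξ₀)` gets `dim (π²)^{K₀⁺} = q³` (directly, or by exactness of `K₀⁺`-fixed vectors) — with NO irreducibility of the Steinberg representation of `U₃(𝔽_q)`.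
WHAT.  `G` acts on the finite `X`, transitively from `x₀` (`htrans`); `B ≤ G` is TRANSITIVE ON `X ∖ {x₀}` (`hBtrans` — with `B` fixing `x₀`, the rank-one ∕
two-double-coset condition `|B̄∖Ḡ∕B̄| = 2`); `k` of characteristic zero; `W ≤ (X → k)` stable under `f ↦ f (g • ·)` (`hW`).
* §1 `sum_apply_perm_eq`, **`sum_eq_zero_of_one_not_mem`** — if `𝟙 ∉ W` then every `f ∈ W` has `Σ_x f x = 0` (the `G`-average of `f` is a constant in `W`).
* §2 **`mem_of_sum_eq_zero_of_fixed`** — if moreover `W` contains a NON-ZERO `B`-fixed vector `φ`, then EVERY mean-zero function lies in `W`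
  (`φ` is constant off `x₀`, mean zero, so `φ ∝ 𝟙 − |X|·δ_{x₀}`; its translates give `𝟙 − |X|·δ_y` for all `y`, whose differences span the mean-zero functions);
  `mem_iff_sum_eq_zero_of_fixed` (`W` IS the mean-zero hyperplane) and **`finrank_eq_card_sub_one_of_fixed`** (`dim W = |X| − 1`).

HONEST LABEL: HC_CM is proved only modulo the 7 printed citations (2 remaining named inputs: hLiu418 = stmt-HodgeConjecture-24832, h413 =
stmt-HodgeConjecture-24833) until rung 0 closes; `--supports stmt-HodgeConjecture-24833` helper, COUNT-NEUTRAL (the socket #20′ it serves is not yet minted).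

## References
* [Borel1976] A. Borel, *Admissible representations of a semi-simple group over a local field with vectors fixed under an Iwahori subgroup*, Invent. Math. 35 (1976), §3–§4.
* [Casselman1995] W. Casselman, *Introduction to the theory of admissible representations of 𝔭-adic reductive groups* (1995), §3.
* [SchneiderStuhler1997] P. Schneider, U. Stuhler, *Representation theory and sheaves on the Bruhat–Tits building*, Publ. Math. IHÉS 85 (1997), §III.4.
-/

set_option autoImplicit false
-- the mandated namespace has the single-problem summit's repeated segment (`HodgeConjecture.HodgeConjecture`)
set_option linter.dupNamespace false

open scoped BigOperators

namespace Summit.HodgeConjecture.HodgeConjecture.Cruxes.H413.K2E3PermutationModuleMeanZeroOfFixed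

variable {G X k : Type*} [Group G] [MulAction G X] [Fintype X] [Field k]

/-! ## §1  A non-spherical translation-stable space consists of mean-zero functions -/

/-- **`Σ_x f (σ x) = Σ_x f x`** for a permutation `σ` of the finite set `X`. [cite: Borel1976, §3] -/
theorem sum_apply_perm_eq (f : X → k) (σ : Equiv.Perm X) : ∑ x, f (σ x) = ∑ x, f x :=
  Fintype.sum_equiv σ _ _ (fun _ => rfl)

/-- **If `𝟙 ∉ W` then `W` is mean-zero.**  `G` acts on the finite `X` transitively from `x₀`, `k` has characteristic zero, `W ≤ (X → k)` is stable under the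
translations `f ↦ f (g • ·)` and does NOT contain the constant function `𝟙` (no «spherical vector»).  Then `Σ_x f x = 0` for every `f ∈ W`: the average of the
translates of `f` over the (finite) image of `G` in `Perm X` is a `G`-invariant, hence constant, element of `W`, so it vanishes, and its total sum is
`|Ḡ|·Σ_x f x`. [cite: Borel1976, §3–§4] [cite: Casselman1995, §3] -/
theorem sum_eq_zero_of_one_not_mem [CharZero k]
    (x₀ : X) (htrans : ∀ x : X, ∃ g : G, g • x₀ = x)
    (W : Submodule k (X → k)) (hW : ∀ (g : G), ∀ f ∈ W, (fun x => f (g • x)) ∈ W)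
    (h1 : (fun _ : X => (1 : k)) ∉ W) {f : X → k} (hf : f ∈ W) : ∑ x, f x = 0 := by
  classical
  set Φ : G →* Equiv.Perm X := MulAction.toPermHom G X with hΦ
  let T : Subgroup (Equiv.Perm X) := Φ.range
  haveI : Fintype T := Fintype.ofFinite _
  have hΦapp : ∀ (g : G) (y : X), (Φ g) y = g • y := fun g y => rfl
  have hT : (Fintype.card T : k) ≠ 0 := Nat.cast_ne_zero.2 Fintype.card_ne_zero
  -- the `G`-average
  let A : X → k := fun y => ∑ σ : T, f ((σ : Equiv.Perm X) y)
  have hA_mem : A ∈ W := by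
    have hterm : ∀ σ : T, (fun y => f ((σ : Equiv.Perm X) y)) ∈ W := by
      intro σ
      obtain ⟨g, hg⟩ := MonoidHom.mem_range.1 σ.2
      have heq : (fun y => f ((σ : Equiv.Perm X) y)) = fun y => f (g • y) := by
        funext y; rw [← hg, hΦapp]
      rw [heq]; exact hW g f hf
    have hAeq : A = ∑ σ : T, (fun y => f ((σ : Equiv.Perm X) y)) := by
      funext y; simp only [A, Finset.sum_apply]
    rw [hAeq]; exact W.sum_mem fun σ _ => hterm σ
  have hA_inv : ∀ (g : G) (y : X), A (g • y) = A y := by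
    intro g y
    simp only [A]
    let τ : T := ⟨Φ g, MonoidHom.mem_range.2 ⟨g, rfl⟩⟩
    refine Fintype.sum_equiv (Equiv.mulRight τ) _ _ (fun σ => ?_)
    simp only [Equiv.coe_mulRight, Subgroup.coe_mul, Equiv.Perm.coe_mul, Function.comp_apply, τ, hΦapp]
  have hA_const : ∀ y, A y = A x₀ := by
    intro y; obtain ⟨g, rfl⟩ := htrans y; exact hA_inv g x₀
  -- `A = (A x₀) • 𝟙`, so `A x₀ = 0` (else `𝟙 ∈ W`)
  have hA0 : A x₀ = 0 := by
    by_contra hne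
    apply h1
    have hsmul : (fun _ : X => (1 : k)) = (A x₀)⁻¹ • A := by
      funext y; simp only [Pi.smul_apply, smul_eq_mul, hA_const y, inv_mul_cancel₀ hne]
    rw [hsmul]; exact W.smul_mem _ hA_mem
  -- total sum of `A` two ways
  have h1' : ∑ y, A y = 0 := by
    rw [Finset.sum_congr rfl (fun y _ => hA_const y), hA0, Finset.sum_const, smul_zero]
  have h2 : ∑ y, A y = (Fintype.card T : k) * ∑ y, f y := by
    simp only [A]
    rw [Finset.sum_comm]
    have hin : ∀ σ : T, ∑ y, f ((σ : Equiv.Perm X) y) = ∑ y, f y := fun σ => sum_apply_perm_eq f σ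
    simp only [hin, Finset.sum_const, Finset.card_univ, nsmul_eq_mul]
  have := h1'.symm.trans h2
  exact (mul_eq_zero.1 this.symm).resolve_left hT

/-! ## §2  Rank one: a non-zero `B`-fixed vector generates the mean-zero hyperplane -/

/-- **THE MEAN-ZERO HYPERPLANE LEMMA (rank one).**  `G` acts on the finite `X` transitively from `x₀`; `B ≤ G` acts TRANSITIVELY ON `X ∖ {x₀}` (in the application `B`
also fixes `x₀` — two `(B, B)`-double cosets `Ḡ = B̄ ⊔ B̄wB̄` — but that is not used); `k` has characteristic zero; `W ≤ (X → k)` is translation-stable, does not contain `𝟙`, and contains a NON-ZERO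
`B`-fixed vector `φ`.  Then every mean-zero function lies in `W`.  (`φ` is constant `= c` off `x₀` and mean-zero (§1), so `c ≠ 0` and `c⁻¹φ = 𝟙 − |X|·δ_{x₀}`; the
translates give `𝟙 − |X|·δ_y ∈ W` for every `y`, hence `δ_y − δ_{x₀} ∈ W`, and `f = Σ_y f(y)(δ_y − δ_{x₀})` for mean-zero `f`.)  Consumer: `N = S^{K₀⁺} ≤ Fun(K₀∕I)` for the
NON-spherical sub-constituent `S` of a depth-zero principal series of `U(3)` — `dim N = [K₀:I] − 1 = q³`. [cite: Borel1976, §3–§4] [cite: Casselman1995, §3] -/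
theorem mem_of_sum_eq_zero_of_fixed [CharZero k] [DecidableEq X]
    (B : Subgroup G) (x₀ : X)
    (hBtrans : ∀ x y : X, x ≠ x₀ → y ≠ x₀ → ∃ b ∈ B, b • x = y)
    (htrans : ∀ x : X, ∃ g : G, g • x₀ = x)
    (W : Submodule k (X → k)) (hW : ∀ (g : G), ∀ f ∈ W, (fun x => f (g • x)) ∈ W)
    (h1 : (fun _ : X => (1 : k)) ∉ W)
    {φ : X → k} (hφ : φ ∈ W) (hφB : ∀ b ∈ B, ∀ x : X, φ (b • x) = φ x) (hφ0 : φ ≠ 0)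
    {f : X → k} (hf : ∑ x, f x = 0) : f ∈ W := by
  classical
  -- `X ≠ {x₀}`: otherwise `φ` is mean-zero on one point, hence zero
  have hmeanφ : ∑ x, φ x = 0 := sum_eq_zero_of_one_not_mem x₀ htrans W hW h1 hφ
  obtain ⟨x₁, hx₁⟩ : ∃ x₁ : X, x₁ ≠ x₀ := by
    by_contra hno
    have hno' : ∀ x : X, x = x₀ := fun x => Classical.not_not.1 fun h => hno ⟨x, h⟩
    apply hφ0
    funext x
    have hx : x = x₀ := hno' x
    haveI : Subsingleton X := ⟨fun a b => (hno' a).trans (hno' b).symm⟩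
    have : ∑ y, φ y = φ x₀ := by
      rw [Fintype.sum_subsingleton _ x₀]
    rw [hx, Pi.zero_apply, ← this, hmeanφ]
  -- `φ` is constant `= c` off `x₀`
  set c := φ x₁ with hc
  have hoff : ∀ x, x ≠ x₀ → φ x = c := by
    intro x hx
    obtain ⟨b, hb, hbx⟩ := hBtrans x₁ x hx₁ hx
    rw [← hbx, hφB b hb]
  -- the value at `x₀` from mean zero: `φ x₀ + (|X| - 1) • c = 0`
  have hsplit : ∑ x, φ x = φ x₀ + ∑ x ∈ Finset.univ.erase x₀, φ x := by
    rw [← Finset.add_sum_erase _ _ (Finset.mem_univ x₀)]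
  have hrest : ∑ x ∈ Finset.univ.erase x₀, φ x = ((Fintype.card X : k) - 1) * c := by
    rw [Finset.sum_congr rfl (fun x hx => hoff x (Finset.ne_of_mem_erase hx)), Finset.sum_const, nsmul_eq_mul,
      Finset.card_erase_of_mem (Finset.mem_univ x₀), Finset.card_univ]
    have hpos : 1 ≤ Fintype.card X := Fintype.card_pos_iff.2 ⟨x₀⟩
    push_cast [Nat.cast_sub hpos]
    ring
  have hx₀val : φ x₀ = -(((Fintype.card X : k) - 1) * c) := by
    have := hmeanφ; rw [hsplit, hrest] at this; linear_combination this
  -- `c ≠ 0`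
  have hc0 : c ≠ 0 := by
    intro h0
    apply hφ0
    funext x
    by_cases hx : x = x₀
    · rw [hx, hx₀val, h0]; simp
    · rw [hoff x hx, h0]; rfl
  -- the normalised vector `ψ y := 𝟙 - |X| • δ_y`; `ψ x₀ = c⁻¹ • φ ∈ W`
  let ψ : X → X → k := fun y x => if x = y then 1 - (Fintype.card X : k) else 1
  have hψx₀ : ψ x₀ = c⁻¹ • φ := by
    funext x
    simp only [ψ, Pi.smul_apply, smul_eq_mul]
    by_cases hx : x = x₀
    · rw [if_pos hx, hx, hx₀val]; field_simp; ring
    · rw [if_neg hx, hoff x hx, inv_mul_cancel₀ hc0]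
  have hψx₀_mem : ψ x₀ ∈ W := by rw [hψx₀]; exact W.smul_mem _ hφ
  -- every translate: `ψ y ∈ W`
  have hψ_mem : ∀ y : X, ψ y ∈ W := by
    intro y
    obtain ⟨g, hg⟩ := htrans y
    have hmem := hW g⁻¹ (ψ x₀) hψx₀_mem
    have heq : (fun x => ψ x₀ (g⁻¹ • x)) = ψ y := by
      funext x
      simp only [ψ]
      have hiff : g⁻¹ • x = x₀ ↔ x = y := by
        rw [← hg, inv_smul_eq_iff]
      by_cases hx : x = y
      · rw [if_pos hx, if_pos (hiff.2 hx)]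
      · rw [if_neg hx, if_neg (fun h => hx (hiff.1 h))]
    rw [heq] at hmem; exact hmem
  -- `δ_y - δ_{x₀} ∈ W`, written through `ψ`: `ψ x₀ - ψ y = |X| • (δ_y - δ_{x₀})`
  have hX : (Fintype.card X : k) ≠ 0 := by
    haveI : Nonempty X := ⟨x₀⟩
    exact Nat.cast_ne_zero.2 Fintype.card_ne_zero
  have hdelta : ∀ y : X, (fun x => (if x = y then (1 : k) else 0) - (if x = x₀ then (1 : k) else 0)) ∈ W := by
    intro y
    have hmem : (Fintype.card X : k)⁻¹ • (ψ x₀ - ψ y) ∈ W := W.smul_mem _ (W.sub_mem hψx₀_mem (hψ_mem y))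
    have heq : (Fintype.card X : k)⁻¹ • (ψ x₀ - ψ y) = fun x => (if x = y then (1 : k) else 0) - (if x = x₀ then (1 : k) else 0) := by
      funext x
      simp only [ψ, Pi.smul_apply, Pi.sub_apply, smul_eq_mul]
      split_ifs <;> field_simp <;> ring
    rw [heq] at hmem; exact hmem
  -- `f = Σ_y f y • (δ_y - δ_{x₀})` for mean-zero `f`
  have hfeq : f = ∑ y, f y • (fun x => (if x = y then (1 : k) else 0) - (if x = x₀ then (1 : k) else 0)) := by
    funext x
    simp only [Finset.sum_apply, Pi.smul_apply, smul_eq_mul, mul_sub, Finset.sum_sub_distrib]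
    rw [Finset.sum_mul_boole, if_pos (Finset.mem_univ x), ← Finset.sum_mul, hf, zero_mul, sub_zero]
  rw [hfeq]
  exact W.sum_mem fun y _ => W.smul_mem _ (hdelta y)

/-- Under the hypotheses of the mean-zero hyperplane lemma, **`W` IS the mean-zero hyperplane**: `f ∈ W ↔ Σ_x f x = 0`. [cite: Borel1976, §3–§4] -/
theorem mem_iff_sum_eq_zero_of_fixed [CharZero k] [DecidableEq X]
    (B : Subgroup G) (x₀ : X)
    (hBtrans : ∀ x y : X, x ≠ x₀ → y ≠ x₀ → ∃ b ∈ B, b • x = y)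
    (htrans : ∀ x : X, ∃ g : G, g • x₀ = x)
    (W : Submodule k (X → k)) (hW : ∀ (g : G), ∀ f ∈ W, (fun x => f (g • x)) ∈ W)
    (h1 : (fun _ : X => (1 : k)) ∉ W)
    {φ : X → k} (hφ : φ ∈ W) (hφB : ∀ b ∈ B, ∀ x : X, φ (b • x) = φ x) (hφ0 : φ ≠ 0)
    (f : X → k) : f ∈ W ↔ ∑ x, f x = 0 :=
  ⟨fun hf => sum_eq_zero_of_one_not_mem x₀ htrans W hW h1 hf,
    fun hf => mem_of_sum_eq_zero_of_fixed B x₀ hBtrans htrans W hW h1 hφ hφB hφ0 hf⟩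

/-- Under the hypotheses of the mean-zero hyperplane lemma, **`dim W = |X| − 1`** (e.g. `dim (π²(ξ₀))^{K₀⁺} = [K₀:I] − 1 = q³` at depth zero).
[cite: Borel1976, §3–§4] [cite: Casselman1995, §3] -/
theorem finrank_eq_card_sub_one_of_fixed [CharZero k] [DecidableEq X]
    (B : Subgroup G) (x₀ : X)
    (hBtrans : ∀ x y : X, x ≠ x₀ → y ≠ x₀ → ∃ b ∈ B, b • x = y)
    (htrans : ∀ x : X, ∃ g : G, g • x₀ = x)
    (W : Submodule k (X → k)) (hW : ∀ (g : G), ∀ f ∈ W, (fun x => f (g • x)) ∈ W)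
    (h1 : (fun _ : X => (1 : k)) ∉ W)
    {φ : X → k} (hφ : φ ∈ W) (hφB : ∀ b ∈ B, ∀ x : X, φ (b • x) = φ x) (hφ0 : φ ≠ 0) :
    Module.finrank k W = Fintype.card X - 1 := by
  classical
  -- `W = ker ℓ` for the total-sum functional `ℓ`
  let ℓ : (X → k) →ₗ[k] k :=
    { toFun := fun f => ∑ x, f x
      map_add' := fun f g => by simp [Finset.sum_add_distrib]
      map_smul' := fun a f => by simp [Finset.mul_sum] }
  have hker : W = LinearMap.ker ℓ := by
    ext f
    rw [LinearMap.mem_ker]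
    exact mem_iff_sum_eq_zero_of_fixed B x₀ hBtrans htrans W hW h1 hφ hφB hφ0 f
  have hsurj : Function.Surjective ℓ := by
    intro a
    refine ⟨fun x => if x = x₀ then a else 0, ?_⟩
    simp [ℓ, Finset.sum_ite_eq']
  have hrange : Module.finrank k (LinearMap.range ℓ) = 1 := by
    rw [LinearMap.range_eq_top.2 hsurj, finrank_top, Module.finrank_self]
  have hrn := LinearMap.finrank_range_add_finrank_ker ℓ
  rw [hrange, Module.finrank_fintype_fun_eq_card] at hrn
  rw [hker]
  omega

end Summit.HodgeConjecture.HodgeConjecture.Cruxes.H413.K2E3PermutationModuleMeanZeroOfFixed
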